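import Mathlib
import HarnessLib
import Literature.Analysis.FluidPDE.SuitableWeak
import Literature.Analysis.FluidPDE.SelfSimilar
import Literature.Analysis.FluidPDE.LocalTypeI
import Literature.Analysis.FluidPDE.SpaceTimeRescaling
import Literature.Analysis.FluidPDE.LocalTypeICongr
import Summits.NavierStokesRegularity.NavierStokesRegularity.Theses.RellichScar

/-!
# Crux ⇔ bet for line `activity-genealogy-fission`, core form (route RellichScar, crux `ApexLocalisation`,
stmt-NavierStokesRegularity-11719; lead c2)

The composition of skeleton v2.1 of the line with the LANDED known stubs taken as hypotheses (so that this
file does not depend on the farm having built today's modules): granted the conclusion of S1b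
`stub_confinementImpliesApex` (confinement ⇒ apex, uniformly in the continuous class; landed p108091, itself fed
by E p106827 and S1a p107264) and S2 `stub_cleanTrunkCompactness` (p108561), the bet T `stub_noPerpetualFission`
implies the crux.

* `apexLocalisation_of_fissionStubs` — S1b-conclusion → S2 → T → crux;
(The converse, crux ⇒ T, is the landed certificate `noPerpetualFission_of_apexLocalisation`, p106403.)
-/

-- the summit and its single sub-problem share the name (CONVENTIONS §1), as in every Theorems file
set_option linter.dupNamespace false

namespace Summit.NavierStokesRegularity.NavierStokesRegularity.Theorems.RellichScarApexLocalisation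

open MeasureTheory Set Function Metric Filter Topology TopologicalSpace
open scoped ENNReal NNReal
open Literature.Analysis Literature.Analysis.FluidPDE

/-- **The bet implies the crux, granted confinement ⇒ apex (S1b) and clean-trunk compactness (S2).**
T gives a class with arbitrarily long clean trunks; S1b at `𝐈 ≤ 4I₁` gives the activity threshold `η`; T the
aperture `R`; S1b the constant `C'`; S2 a confined origin-singular continuous profile with `𝐈 ≤ 4I₁`; S1b its apex
bound. -/
theorem apexLocalisation_of_fissionStubs
    (hS1b : ∀ (C : ℝ) (I : ℝ≥0∞), I < ⊤ → ∃ η : ℝ, 0 < η ∧ ∀ R : ℝ, 0 < R → ∃ C' : ℝ, ∀ (u : ℝ → (EuclideanSpace ℝ (Fin 3)) → (EuclideanSpace ℝ (Fin 3))) (p : ℝ → (EuclideanSpace ℝ (Fin 3)) → ℝ) (G : ℝ → (EuclideanSpace ℝ (Fin 3)) → (EuclideanSpace ℝ (Fin 3)) →L[ℝ] (EuclideanSpace ℝ (Fin 3))), IsSuitableWeakSolutionOn (slab (EuclideanSpace ℝ (Fin 3)) (Iio 0) isOpen_Iio) 1 0 u p → HasWeakSpatialGradientOn (slab (EuclideanSpace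 ℝ (Fin 3)) (Iio 0) isOpen_Iio) u G → typeIBound (Iio (0 : ℝ) ×ˢ univ) u p G ≤ I → HasTypeITimeDecay C u → ContinuousOn (uncurry u) (Iio (0 : ℝ) ×ˢ univ) → (∀ t : ℝ, t < 0 → ∀ x : (EuclideanSpace ℝ (Fin 3)), R * Real.sqrt (-t) ≤ ‖x‖ → Real.sqrt (-t) * ‖u t x‖ ≤ η) → HasTypeIDecay C' u)
    (hS2 : ∀ (C : ℝ) (I : ℝ≥0∞) (η R : ℝ), I < ⊤ → 0 < R → (∀ ε : ℝ, 0 < ε → ∃ (u : ℝ → (EuclideanSpace ℝ (Fin 3)) → (EuclideanSpace ℝ (Fin 3))) (p : ℝ → (EuclideanSpace ℝ (Fin 3)) → ℝ) (G : ℝ → (EuclideanSpace ℝ (Fin 3)) → (EuclideanSpace ℝ (Fin 3)) →L[ℝ] (EuclideanSpace ℝ (Fin 3))), IsSuitableWeakSolutionOn (slab (EuclideanSpace ℝ (Fin 3)) (Iio 0) isOpen_Iio) 1 0 u p ∧ HasWeakSpatialGradientOn (slab (EuclideanSpace ℝ (Fin 3)) (Iio 0) isOpen_Iio) u G ∧ typeIBound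 (Iio (0 : ℝ) ×ˢ univ) u p G ≤ I ∧ HasTypeITimeDecay C u ∧ ContinuousOn (uncurry u) (Iio (0 : ℝ) ×ˢ univ) ∧ IsBackwardSingularPoint u 0 ∧ ∀ t : ℝ, t < 0 → ∀ x : (EuclideanSpace ℝ (Fin 3)), ε ≤ ‖x‖ + Real.sqrt (-t) → ‖x‖ + Real.sqrt (-t) ≤ ε⁻¹ → R * Real.sqrt (-t) ≤ ‖x‖ → Real.sqrt (-t) * ‖u t x‖ ≤ η) → ∃ (u : ℝ → (EuclideanSpace ℝ (Fin 3)) → (EuclideanSpace ℝ (Fin 3))) (p : ℝ → (EuclideanSpace ℝ (Fin 3)) → ℝ) (G : ℝ → (EuclideanSpace ℝ (Fin 3)) → (EuclideanSpace ℝ (Fin 3)) →L[ℝ] (EuclideanSpace ℝ (Fin 3))), IsSuitableWeakSolutionOn (slab (EuclideanSpace ℝ (Fin 3)) (Iio 0) isOpen_Iio) 1 0 u p ∧ HasWeakSpatialGradientOn (slab (EuclideanSpace ℝ (Fin 3)) (Iio 0) isOpen_Iio) u G ∧ typeIBound (Iio (0 : ℝ) ×ˢ univ) u p G ≤ 4 *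 I ∧ HasTypeITimeDecay C u ∧ ContinuousOn (uncurry u) (Iio (0 : ℝ) ×ˢ univ) ∧ IsBackwardSingularPoint u 0 ∧ ∀ t : ℝ, t < 0 → ∀ x : (EuclideanSpace ℝ (Fin 3)), R * Real.sqrt (-t) ≤ ‖x‖ → Real.sqrt (-t) * ‖u t x‖ ≤ η)
    (hT : ∀ C : ℝ, (∃ (u : ℝ → (EuclideanSpace ℝ (Fin 3)) → (EuclideanSpace ℝ (Fin 3))) (p : ℝ → (EuclideanSpace ℝ (Fin 3)) → ℝ) (G : ℝ → (EuclideanSpace ℝ (Fin 3)) → (EuclideanSpace ℝ (Fin 3)) →L[ℝ] (EuclideanSpace ℝ (Fin 3))), IsSuitableWeakSolutionOn (slab (EuclideanSpace ℝ (Fin 3)) (Iio 0) isOpen_Iio) 1 0 u p ∧ HasWeakSpatialGradientOn (slab (EuclideanSpace ℝ (Fin 3)) (Iio 0) isOpen_Iio) u G ∧ typeIBound (Set.Iio (0 : ℝ) ×ˢ Set.univ) u p G < ⊤ ∧ HasTypeITimeDecay C u ∧ IsBackwardSingularPoint u 0) → ∃ (C₁ : ℝ) (I₁ : ℝ≥0∞),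 I₁ < ⊤ ∧ ∀ η : ℝ, 0 < η → ∃ R : ℝ, 0 < R ∧ ∀ ε : ℝ, 0 < ε → ∃ (u : ℝ → (EuclideanSpace ℝ (Fin 3)) → (EuclideanSpace ℝ (Fin 3))) (p : ℝ → (EuclideanSpace ℝ (Fin 3)) → ℝ) (G : ℝ → (EuclideanSpace ℝ (Fin 3)) → (EuclideanSpace ℝ (Fin 3)) →L[ℝ] (EuclideanSpace ℝ (Fin 3))), IsSuitableWeakSolutionOn (slab (EuclideanSpace ℝ (Fin 3)) (Iio 0) isOpen_Iio) 1 0 u p ∧ HasWeakSpatialGradientOn (slab (EuclideanSpace ℝ (Fin 3)) (Iio 0) isOpen_Iio) u G ∧ typeIBound (Iio (0 : ℝ) ×ˢ univ) u p G ≤ I₁ ∧ HasTypeITimeDecay C₁ u ∧ ContinuousOn (uncurry u) (Iio (0 : ℝ) ×ˢ univ) ∧ IsBackwardSingularPoint u 0 ∧ ∀ t : ℝ, t < 0 → ∀ x : (EuclideanSpace ℝ (Fin 3)), ε ≤ ‖x‖ + Real.sqrt (-t) → ‖x‖ + Real.sqrt (-t) ≤ ε⁻¹ → R * Real.sqrt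 (-t) ≤ ‖x‖ → Real.sqrt (-t) * ‖u t x‖ ≤ η) :
    Summit.NavierStokesRegularity.NavierStokesRegularity.Theses.RellichScar.ApexLocalisation := by
  intro C hant
  obtain ⟨C₁, I₁, hI₁, hT'⟩ := hT C hant
  have h4I : 4 * I₁ < ⊤ := ENNReal.mul_lt_top (by simp) hI₁
  obtain ⟨η, hη, hconf⟩ := hS1b C₁ (4 * I₁) h4I
  obtain ⟨R, hR, hwin⟩ := hT' η hη
  obtain ⟨C', hC'⟩ := hconf R hR
  obtain ⟨u, p, G, hsw, hwg, hIle, hC, hcont, hsing, hquiet⟩ := hS2 C₁ I₁ η R hI₁ hR hwin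
  exact ⟨C', u, p, G, hsw, hwg, lt_of_le_of_lt hIle h4I, hC' u p G hsw hwg hIle hC hcont hquiet, hsing⟩

end Summit.NavierStokesRegularity.NavierStokesRegularity.Theorems.RellichScarApexLocalisation
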